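import Summits.QuantumFields.YangMills.Theorems.UV3PinnedStepOrganOfMassEnvelope
import Summits.QuantumFields.YangMills.Theorems.BalabanUVNodesN08PartialIteratesSufficiency
import HarnessLib

/-!
# R3 (cell `ym3-torus`, YM₃ on T³ — a ladder RUNG, NOT d = 4, NOT infinite volume, NOT a mass gap, NOT the Clay problem) —
# **R-19936-S: THE ORGAN ROW (S-ii) `hSii` FROM THE PURELY KINEMATIC ROW (a)′∀ «ALL PARTIAL ITERATED PUSH-FORWARDS OF HAAR UNDER THE
# FAMILY'S BLOCK AVERAGING ARE `≤ e^{c}·HAAR`» — THE FLOOR DEFECT `log(K+1)` OF THE v1 MASSES IS ABSORBED BY THE CONSTRAINED HEIGHTS**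

LEAD seat `ym-ust-19936-w1` g11 on crux `stmt-QuantumFields-19936` `UnitScaleTilt.HistoryTailL` (`--supports`, helper; THEOREMS ONLY, 0 `def`,
0 `sorry`).  A scope theorem in the series K-17 … K-20 (what the history-tail organ really consumes).

THE POINT.  After `ym-ust-19936-w6` g7's FILE 3c ✓`UV3PinnedStepOrganOfMassEnvelope` the S organ row `hSii` of the registered stub
`stub_pinnedStep` (skeleton `pinned_stability.lean` v3) is a theorem modulo the displayed row hJ «`m_K(r,·) ≤ e^{A₁}` `dV_K`-a.e. for every
admissible non-trivial history, UNIFORMLY IN `K`» (★★OWNER WORD 58).  In the v1 currency the masses `MassesAC.massRecAC` FLOOR the trivial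
history at `1` at every level, and the pub-ymgap N08 files bracket every a.e. mass letter by statements about ITERATED PUSH-FORWARDS OF HAAR
ALONE: necessary (a)′ (✓`…N08TrivialHistoryIteratedTransport`), sufficient (a)′∀ UP TO THE FACTOR `K + 1`
(✓`…N08PartialIteratesSufficiency.massRecAC_le_exp_mul_ae_of_partialIterates_le`: `m_K(h,·) ≤ (K+1)·e^{c}` a.e., EVERY history) — the
`log(K+1)` being the price of the floors («no-stacking», located, unresolved).  THIS FILE shows the `log(K+1)` defect is OFF the critical path of
`HistoryTailL`: the (S-ii) row reads the masses only at the CONSTRAINED heights `j + ⌊(K−1)∕m⌋ ≤ K` (LEAD finding (3), v15) and carries a free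
power `β_{K−j}^A` of the inverse effective coupling `β_{K−j} = γ⁻¹L^{K−j}`; there `K + 1 ≤ (m+2)·β_{K−j}` (§1), so a LINEAR-IN-`K` mass
envelope gives `hSii` VERBATIM with `A := 1` (§2), and (a)′∀ for the family's block averaging `avT3 F K` (= `blockAvg ℰp` in range) gives the
linear envelope for EVERY history by the N08 sufficiency theorem (§3).  Net (§3 ★★★ `hSii_of_partialIterates`, §4 the `∀ L` binder of the
faces): **R-19936-S displays, beyond the (α) socket and `hMain`, ONLY (a)′∀ — a statement about `blockAvg ℰp` and Haar with no histories, no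
weights, no Z-terms and no floors** (the instrument row B2 ∕ «JOB HJ» of ideator ym-r3-idea-2 g17 tests exactly this object).

CONTENTS.
* §1 `succ_le_mul_beta` — `K + 1 ≤ (m+2)·(γ·L^{−(K−j)})⁻¹` for `0 < m`, `j + 2 ≤ K`, `j + ⌊(K−1)∕m⌋ ≤ K`, `0 < γ ≤ 1`, `2 ≤ L` (elementary:
  `K + 1 ≤ (m+2)(n+1)`, `n + 1 ≤ 2^n ≤ L^n ≤ L^{K−j}`, `n = ⌊(K−1)∕m⌋`).
* §2 ★★ `AlphaInputsT3AC.Of.hSii_of_linMassEnvelope` — `hSii` (✓p750864's binder VERBATIM) from the LINEAR envelope «`m_K(r,·) ≤ (K+1)·e^{A₁}`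
  a.e., admissible non-trivial `r`»: FILE 3c's `pinnedLF_le_of_massEnvelope` at `A₁ + log(K+1)`, then §1; `A := 1`,
  `CZ := A₁ + (6∕log L)(2L^m)³ + log(1 + C_coll∕ℓ) + log(m+2)`, `c := c₁∕16 = 1∕128`.
* §3 ★★ `AlphaInputsT3AC.Of.linMassEnvelopeAll_of_partialIterates` ∕ `…linMassEnvelope_of_partialIterates` — (a)′∀ at every run
  (`ι_{j,k} ≤ e^{c}·dU_k`, `j < k ≤ K`, the partial iterates of Haar under `avT3 F K`) ⇒ the linear envelope for EVERY history (trivial included;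
  N08 sufficiency; the package's averaging IS `avT3 F K` and its masses ARE `massRecAC`, both `rfl`) ∕ in hJ's shape;
  ★★★ `AlphaInputsT3AC.Of.hSii_of_partialIterates` — the composition.
* §4 ★★★ `hSii_forall_of_partialIterates` — the `∀ L`-binder `hSii` of ✓`UV3PinnedStepKnitOfPackage.hPinA_of_pinnedLF` ∕ ✓p751371
  `UnitScaleTiltHistoryTailOfPackagePinnedLf.pinnedHeightTail_of_package_of_pinnedLF_of_lf_ae_of_main` from the sockets and (a)′∀ per family
  (threshold `γ₁ := 1`).

HONEST SCOPE.  Bookkeeping over landed theorems; (a)′∀ is DISPLAYED (a hypothesis), NOT proved — for the tree's `blockAvg ℰp` it is OPEN (one step: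
`Ū_*(dU) ≤ D·dV` is not `T1 = 1`; lit `AveragingImageLawGaugeInvariance`); the U organ row `hlf` is NOT touched here (its v1 letter is K-uniform at
the trivial history, where (a)′∀ gives only `(K+1)·e^{c}` — the U-side twin with the same absorption goes through the door's `M`, a registry matter);
nothing of `stub_pinnedStep`, `stub_unitEnvelope`, `hP′`, `HistoryTailL` (19936), the rung `YM3TorusSU2`, any continuum limit, d = 4, a mass gap or
Clay is proved here.  YM₃ on T³ is rung R3 of the ladder, not the Clay problem.

References: T. Bałaban, Commun. Math. Phys. **102** (1985) 255–275 [Balaban1985UV3] ((41) p. 266, (2) p. 256, (5) p. 257, (67)–(71) p. 273);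
T. Bałaban, Commun. Math. Phys. **98** (1985) 17–51 [Balaban1985Averaging] ((15) p. 19).
-/

set_option autoImplicit false

noncomputable section

namespace Summit.QuantumFields.YangMills.Theorems.UV3PinnedStepOrganOfPartialIterates

open MeasureTheory
open scoped BigOperators ENNReal
open Literature.MathematicalPhysics.QuantumFieldTheory.Balaban1983to89
open Literature.MathematicalPhysics.QuantumFieldTheory.Balaban1983to89.T3ContinuumYM3Torus
open Literature.MathematicalPhysics.QuantumFieldTheory.Balaban1983to89.T3UnitLawDensityEML (ℰp)
open Literature.MathematicalPhysics.QuantumFieldTheory.Balaban1985CMP102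
open Literature.MathematicalPhysics.QuantumFieldTheory.Balaban1985CMP102.Setting
open Summit.QuantumFields.Balaban3D.Carriers
open Summit.QuantumFields.Balaban3D.Proofs.Primitives
open Summit.QuantumFields.Balaban3D.Proofs.TowerAC
open Summit.QuantumFields.Balaban3D.Proofs.StandardAC
open Summit.QuantumFields.Balaban3D.Proofs.InputsAC
open Summit.QuantumFields.Balaban3D.Proofs.MassesAC
open Summit.QuantumFields.YangMills.Theorems.UV3PinnedStepOrganOfMassEnvelope (pinnedLF_le_of_massEnvelope)
open Summit.QuantumFields.YangMills.BalabanUVNodes.N08PartialIteratesSufficiency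
  (exists_partialIterates massRecAC_le_exp_mul_ae_of_partialIterates_le)

/-! ## §1 The constrained heights absorb a factor linear in the run length -/

/-- **`K + 1 ≤ (m+2)·β_{K−j}` AT THE CONSTRAINED HEIGHTS**: for `0 < m`, `j + 2 ≤ K`, `j + ⌊(K−1)∕m⌋ ≤ K`, `0 < γ ≤ 1` and `2 ≤ L`,
`K + 1 ≤ (m + 2)·(γ·L^{−(K−j)})⁻¹` — with `n := ⌊(K−1)∕m⌋ ≤ K − j`: `K + 1 ≤ m(n+1) + 2 ≤ (m+2)(n+1)`, `n + 1 ≤ 2^n ≤ L^n ≤ L^{K−j} ≤ γ⁻¹L^{K−j}`.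
(The inverse effective coupling of the family's scheme is `β_{K−j} = (γ·(L⁻¹)^{K−j})⁻¹`, `T3ContinuumYM3Torus.T3Family.scheme`.) [folklore] -/
theorem succ_le_mul_beta {L m K j : ℕ} (hL : 2 ≤ L) (hm : 0 < m) (hjK : j + 2 ≤ K) (hjm : j + (K - 1) / m ≤ K)
    {γ : ℝ} (hγ : 0 < γ) (hγ1 : γ ≤ 1) :
    (K : ℝ) + 1 ≤ ((m : ℝ) + 2) * (γ * ((L : ℝ)⁻¹) ^ (K - j))⁻¹ := by
  set n : ℕ := (K - 1) / m with hn
  have hnKj : n ≤ K - j := by omega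
  -- `K + 1 ≤ (m+2)(n+1)` in `ℕ`
  have hdiv : K - 1 < n * m + m := by
    have := Nat.lt_div_mul_add (a := K - 1) hm
    simpa [hn] using this
  have hK1 : K + 1 ≤ (m + 2) * (n + 1) := by
    have h1 : K ≤ n * m + m := by omega
    nlinarith
  have hK1r : (K : ℝ) + 1 ≤ ((m : ℝ) + 2) * ((n : ℝ) + 1) := by exact_mod_cast hK1
  -- `n + 1 ≤ 2^n ≤ L^n ≤ L^{K-j}`
  have hn2 : (n : ℝ) + 1 ≤ (L : ℝ) ^ (K - j) := by
    have h2 : n + 1 ≤ 2 ^ n := n.lt_two_pow_self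
    have h3 : (2 : ℕ) ^ n ≤ L ^ n := Nat.pow_le_pow_left hL n
    have h4 : L ^ n ≤ L ^ (K - j) := Nat.pow_le_pow_right (by omega) hnKj
    have : n + 1 ≤ L ^ (K - j) := h2.trans (h3.trans h4)
    exact_mod_cast this
  have hLpos : (0 : ℝ) < (L : ℝ) := by exact_mod_cast (show 0 < L by omega)
  have hLpow : (0 : ℝ) < (L : ℝ) ^ (K - j) := pow_pos hLpos _
  -- `(γ·(L⁻¹)^{K-j})⁻¹ = γ⁻¹·L^{K-j} ≥ L^{K-j}`
  have hβ : (L : ℝ) ^ (K - j) ≤ (γ * ((L : ℝ)⁻¹) ^ (K - j))⁻¹ := by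
    rw [inv_pow, mul_inv, inv_inv]
    have hγinv : (1 : ℝ) ≤ γ⁻¹ := one_le_inv_iff₀.mpr ⟨hγ, hγ1⟩
    nlinarith
  have hm2 : (0 : ℝ) ≤ (m : ℝ) + 2 := by positivity
  calc (K : ℝ) + 1 ≤ ((m : ℝ) + 2) * ((n : ℝ) + 1) := hK1r
    _ ≤ ((m : ℝ) + 2) * (L : ℝ) ^ (K - j) := mul_le_mul_of_nonneg_left hn2 hm2
    _ ≤ ((m : ℝ) + 2) * (γ * ((L : ℝ)⁻¹) ^ (K - j))⁻¹ := mul_le_mul_of_nonneg_left hβ hm2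

variable {F : T3Family} {𝔠 : AlphaConsts F.L (suGroupModel 2).N}

/-! ## §2 The (S-ii) row from a mass envelope LINEAR in the run length -/

open Classical in
/-- ★★ **THE ORGAN ROW (S-ii) `hSii` (✓p750864 `UV3PinnedStepKnitOfPackage.pinnedTop_of_pinnedLF`'s binder, VERBATIM) FROM A MASS ENVELOPE LINEAR IN
THE RUN LENGTH.**  Per family `F`, record `𝔠`, socket `h : Of F 𝔠`, coupling `γ` in the window and depth `m > 0`: IF there is `A₁` with
`m_K(r,·) ≤ (K+1)·e^{A₁}` `dV_K`-a.e. for every run `K` and every admissible non-trivial history `r` (the shape the N08 sufficiency theorem delivers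
from (a)′∀, floors included), THEN `hSii` holds with `A := 1`: FILE 3c's ✓`pinnedLF_le_of_massEnvelope` at the envelope `A₁ + log(K+1)` gives the
restricted sum `≤ (K+1)·e^{CZ₀}·e^{−(c₁∕16)p(g_{K−j})²}`, and at the constrained heights `K + 1 ≤ (m+2)·β_{K−j}` (§1), so
`CZ := CZ₀ + log(m+2)`, `c := c₁∕16`, `A := 1`.  The `log(K+1)` floor defect of the v1 masses is thereby OFF the critical path of the S organ.
[cite: Balaban1985UV3, (41) p.266, (67)–(71) p.273, pp.273–274, (7) p.257] -/
theorem _root_.Summit.QuantumFields.YangMills.Theorems.AlphaInputsT3AC.Of.hSii_of_linMassEnvelope (h : AlphaInputsT3AC.Of F 𝔠)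
    (γ : ℝ) (hγ : 0 < γ) (hγ1 : γ ≤ (min 𝔠.gamma0 1) ^ 2) (m : ℕ) (hm : 0 < m)
    (hJ : ∃ A₁ : ℝ, ∀ (K : ℕ) (r : Hist (F.P K) K),
      Hist.Admissible 𝔠.lane.carrier.M₁ (rcolOf (T3Scales F γ hγ (hγ1.trans (sq_min_one_le _ 𝔠.gamma0_pos)) K) 𝔠.lane.carrier) K r →
      r ≠ Hist.triv (F.P K) K →
      ∀ᵐ W ∂(fieldMeasure (F.P K) K (Matrix.specialUnitaryGroup (Fin 2) ℂ)),
        (inputOfAC 𝔠.lane (h.pkgAt γ hγ hγ1 K).X (h.pkgAt γ hγ hγ1 K).𝔖).W.mass K r W ≤ ((K : ℝ) + 1) * Real.exp A₁) :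
    ∃ (CZ c : ℝ) (A : ℕ), 0 < c ∧
      ∀ (K j : ℕ) (hj1 : 1 ≤ j) (hjK : j + 2 ≤ K), j + (K - 1) / m ≤ K → ∀ (a : Plaq (F.P K) j),
        ∀ᵐ W ∂(fieldMeasure (F.P K) K (Matrix.specialUnitaryGroup (Fin 2) ℂ)),
        ∑ r ∈ Finset.univ.filter (fun r : Hist (F.P K) K =>
            a ∈ r ⟨j, by omega⟩ ∨ ¬ plaqCover a ⊆ Omega 𝔠.lane.carrier.M₁
              (rcolOf (T3Scales F γ hγ (hγ1.trans (sq_min_one_le _ 𝔠.gamma0_pos)) K) 𝔠.lane.carrier) j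
              (fun i : Fin j => r (Fin.castLE (by omega) i)) j),
          (inputOfAC 𝔠.lane (h.pkgAt γ hγ hγ1 K).X (h.pkgAt γ hγ hγ1 K).𝔖).W.mass K r W *
            Real.exp (-((h.pkgAt γ hγ hγ1 K).T.mainT K r W) + (h.pkgAt γ hγ hγ1 K).T.Zterm K r) ≤
        Real.exp CZ * ((F.scheme ℰp γ).β (K - j) ^ A *
          Real.exp (-(c * B10.pFun 𝔠.b₀ 𝔠.p₀ (Real.sqrt (γ * ((F.L : ℝ)⁻¹) ^ (K - j))) ^ 2))) := by
  obtain ⟨A₁, hA⟩ := hJ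
  have hNpos : (0 : ℝ) < ((suGroupModel 2).N : ℝ) := by exact_mod_cast (suGroupModel 2).N_pos
  have hL : 2 ≤ F.L := F.hL.2
  have hγle1 : γ ≤ 1 := hγ1.trans (sq_min_one_le _ 𝔠.gamma0_pos)
  refine ⟨A₁ + 3 / (Real.log F.L / 2) * (2 * (F.L : ℝ) ^ F.m) ^ 3 +
      Real.log (1 + 9 * (2 * (2 * ((𝔠.lane.carrier.R₁ + 1) * 𝔠.lane.carrier.M₁) +
        2 * ((F.L : ℝ) * (3 * ((𝔠.lane.carrier.M₁ : ℝ) - 1)) + 3 * ((F.L : ℝ) - 1)) + 15 * F.L + 7) + 6) ^ 3 / (Real.log F.L / 2)) +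
      Real.log ((m : ℝ) + 2),
    1 / (4 * ((suGroupModel 2).N : ℝ)) / 16, 1, by positivity, fun K j hj1 hjK hjm a => ?_⟩
  -- gather the finitely many a.e. envelopes of run `K`, in exponential form
  have hK1 : (0 : ℝ) < (K : ℝ) + 1 := by positivity
  have hae : ∀ᵐ W ∂(fieldMeasure (F.P K) K (Matrix.specialUnitaryGroup (Fin 2) ℂ)), ∀ r : Hist (F.P K) K,
      Hist.Admissible 𝔠.lane.carrier.M₁ (rcolOf (T3Scales F γ hγ (hγ1.trans (sq_min_one_le _ 𝔠.gamma0_pos)) K) 𝔠.lane.carrier) K r →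
      r ≠ Hist.triv (F.P K) K → (inputOfAC 𝔠.lane (h.pkgAt γ hγ hγ1 K).X (h.pkgAt γ hγ hγ1 K).𝔖).W.mass K r W ≤
        Real.exp (A₁ + Real.log ((K : ℝ) + 1)) := by
    refine ae_all_iff.2 fun r => ?_
    by_cases hadm : Hist.Admissible 𝔠.lane.carrier.M₁
      (rcolOf (T3Scales F γ hγ (hγ1.trans (sq_min_one_le _ 𝔠.gamma0_pos)) K) 𝔠.lane.carrier) K r
    · by_cases hne : r = Hist.triv (F.P K) K
      · exact Filter.Eventually.of_forall fun W _ h2 => absurd hne h2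
      · filter_upwards [hA K r hadm hne] with W hW
        intro _ _
        rw [Real.exp_add, Real.exp_log hK1, mul_comm]
        exact hW
    · exact Filter.Eventually.of_forall fun W h1 _ => absurd h1 hadm
  filter_upwards [hae] with W hW
  have h3 := pinnedLF_le_of_massEnvelope (h.pkgAt γ hγ hγ1 K) (by omega) a W hW
  -- abstract FILE 3c's two constants and the rate factor
  set X : ℝ := 3 / (Real.log F.L / 2) * (2 * (F.L : ℝ) ^ F.m) ^ 3 with hX
  set Y : ℝ := Real.log (1 + 9 * (2 * (2 * ((𝔠.lane.carrier.R₁ + 1) * 𝔠.lane.carrier.M₁) +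
        2 * ((F.L : ℝ) * (3 * ((𝔠.lane.carrier.M₁ : ℝ) - 1)) + 3 * ((F.L : ℝ) - 1)) + 15 * F.L + 7) + 6) ^ 3 / (Real.log F.L / 2)) with hY
  set R : ℝ := Real.exp (-(1 / (4 * ((suGroupModel 2).N : ℝ)) / 16 *
      B10.pFun 𝔠.b₀ 𝔠.p₀ (Real.sqrt (γ * ((F.L : ℝ)⁻¹) ^ (K - j))) ^ 2)) with hR
  -- `exp(A₁ + log(K+1) + X + Y) = (K+1)·exp(A₁ + X + Y)` and `K + 1 ≤ (m+2)·β_{K-j}`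
  have hβ : (K : ℝ) + 1 ≤ ((m : ℝ) + 2) * (F.scheme ℰp γ).β (K - j) :=
    succ_le_mul_beta hL hm hjK hjm hγ hγle1
  have hm2 : (0 : ℝ) < (m : ℝ) + 2 := by positivity
  have hexp : Real.exp (A₁ + Real.log ((K : ℝ) + 1) + X + Y) = ((K : ℝ) + 1) * Real.exp (A₁ + X + Y) := by
    rw [show A₁ + Real.log ((K : ℝ) + 1) + X + Y = (A₁ + X + Y) + Real.log ((K : ℝ) + 1) by ring,
      Real.exp_add, Real.exp_log hK1, mul_comm]
  have hCZ : Real.exp (A₁ + X + Y + Real.log ((m : ℝ) + 2)) = ((m : ℝ) + 2) * Real.exp (A₁ + X + Y) := by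
    rw [Real.exp_add, Real.exp_log hm2, mul_comm]
  have hR0 : 0 ≤ R := by rw [hR]; exact (Real.exp_pos _).le
  have hE0 : 0 ≤ Real.exp (A₁ + X + Y) * R := mul_nonneg (Real.exp_pos _).le hR0
  rw [hexp] at h3
  rw [hCZ, pow_one]
  calc _ ≤ ((K : ℝ) + 1) * Real.exp (A₁ + X + Y) * R := h3
    _ = ((K : ℝ) + 1) * (Real.exp (A₁ + X + Y) * R) := by ring
    _ ≤ ((m : ℝ) + 2) * (F.scheme ℰp γ).β (K - j) * (Real.exp (A₁ + X + Y) * R) := mul_le_mul_of_nonneg_right hβ hE0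
    _ = ((m : ℝ) + 2) * Real.exp (A₁ + X + Y) * ((F.scheme ℰp γ).β (K - j) * R) := by ring

/-! ## §3 The linear envelope, for EVERY history, from (a)′∀ for the family's block averaging -/

/-- ★★ **(a)′∀ AT EVERY RUN ⇒ THE LINEAR MASS ENVELOPE FOR EVERY HISTORY (the trivial one included).**  The package's averaging at run `K` IS
the family's pinned block averaging `avT3 F K` (`XT3_av`, `rfl`) and its masses ARE the exact transports `massRecAC` (`StandardAC.stdTowerInputAC_mass`,
`rfl`); so if, at every run `K`, every partial iterated push-forward of Haar `ι_{j,k} = (Ū_{k−1}∘⋯∘Ū_j)_*dU_j` (`ι_{j,j} = dU_j`, `ι_{j,k+1} = ι_{j,k}∘Ū_k⁻¹`)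
obeys `ι_{j,k} ≤ e^{c}·dU_k` for `j < k ≤ K` with ONE `c ≥ 0` (per family: per-volume constants are admissible for the history tail, LEAD finding (4)),
then `m_K(r,·) ≤ (K+1)·e^{c}` `dV_K`-a.e. for EVERY history `r` — floors of the trivial history included
(✓`…N08PartialIteratesSufficiency.massRecAC_le_exp_mul_ae_of_partialIterates_le` at `AvgAC (avT3 F K)` = ✓`avgAC_avT3`).  This is the form the
U organ (`hlf`, which sums the trivial history too) can use. [cite: Balaban1985UV3, (41) p.266 + (2) p.256 + (5) p.257; Balaban1985Averaging, (15) p.19] -/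
theorem _root_.Summit.QuantumFields.YangMills.Theorems.AlphaInputsT3AC.Of.linMassEnvelopeAll_of_partialIterates (h : AlphaInputsT3AC.Of F 𝔠)
    (γ : ℝ) (hγ : 0 < γ) (hγ1 : γ ≤ (min 𝔠.gamma0 1) ^ 2)
    (hPI : ∃ c : ℝ, 0 ≤ c ∧ ∀ (K : ℕ) (ι : ∀ j k : ℕ, Measure (GaugeField (F.P K) k (Matrix.specialUnitaryGroup (Fin 2) ℂ))),
      (∀ j, ι j j = fieldMeasure (F.P K) j (Matrix.specialUnitaryGroup (Fin 2) ℂ)) →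
      (∀ j k, j ≤ k → ι j (k + 1) = (ι j k).map (avT3 F K k).avg) →
      ∀ j k, j < k → k ≤ K → ι j k ≤ ENNReal.ofReal (Real.exp c) • fieldMeasure (F.P K) k (Matrix.specialUnitaryGroup (Fin 2) ℂ)) :
    ∃ A₁ : ℝ, ∀ (K : ℕ) (r : Hist (F.P K) K),
      ∀ᵐ W ∂(fieldMeasure (F.P K) K (Matrix.specialUnitaryGroup (Fin 2) ℂ)),
        (inputOfAC 𝔠.lane (h.pkgAt γ hγ hγ1 K).X (h.pkgAt γ hγ hγ1 K).𝔖).W.mass K r W ≤ ((K : ℝ) + 1) * Real.exp A₁ := by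
  obtain ⟨c, hc0, hc⟩ := hPI
  refine ⟨c, fun K r => ?_⟩
  obtain ⟨ι, hι0, hιs⟩ := exists_partialIterates (avT3 F K)
  have key := massRecAC_le_exp_mul_ae_of_partialIterates_le 𝔠.lane.carrier.M₁
    (rcolOf (T3Scales F γ hγ (hγ1.trans (sq_min_one_le _ 𝔠.gamma0_pos)) K) 𝔠.lane.carrier)
    (eps1Of (T3Scales F γ hγ (hγ1.trans (sq_min_one_le _ 𝔠.gamma0_pos)) K) 𝔠.lane.carrier)
    (epsSOf (T3Scales F γ hγ (hγ1.trans (sq_min_one_le _ 𝔠.gamma0_pos)) K) 𝔠.lane.carrier)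
    (avT3 F K) (avgAC_avT3 F K) ι hι0 hιs K (fun _ => c) (fun _ => hc0) (fun j k hjk hkK => hc K ι hι0 hιs j k hjk hkK) K le_rfl r
  filter_upwards [key] with W hW
  exact hW

/-- ★★ **(a)′∀ AT EVERY RUN ⇒ THE LINEAR MASS ENVELOPE IN hJ's SHAPE** (admissible non-trivial histories; the special case of
`linMassEnvelopeAll_of_partialIterates` the S organ consumes). [cite: Balaban1985UV3, (41) p.266 + (2) p.256 + (5) p.257; Balaban1985Averaging, (15) p.19] -/
theorem _root_.Summit.QuantumFields.YangMills.Theorems.AlphaInputsT3AC.Of.linMassEnvelope_of_partialIterates (h : AlphaInputsT3AC.Of F 𝔠)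
    (γ : ℝ) (hγ : 0 < γ) (hγ1 : γ ≤ (min 𝔠.gamma0 1) ^ 2)
    (hPI : ∃ c : ℝ, 0 ≤ c ∧ ∀ (K : ℕ) (ι : ∀ j k : ℕ, Measure (GaugeField (F.P K) k (Matrix.specialUnitaryGroup (Fin 2) ℂ))),
      (∀ j, ι j j = fieldMeasure (F.P K) j (Matrix.specialUnitaryGroup (Fin 2) ℂ)) →
      (∀ j k, j ≤ k → ι j (k + 1) = (ι j k).map (avT3 F K k).avg) →
      ∀ j k, j < k → k ≤ K → ι j k ≤ ENNReal.ofReal (Real.exp c) • fieldMeasure (F.P K) k (Matrix.specialUnitaryGroup (Fin 2) ℂ)) :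
    ∃ A₁ : ℝ, ∀ (K : ℕ) (r : Hist (F.P K) K),
      Hist.Admissible 𝔠.lane.carrier.M₁ (rcolOf (T3Scales F γ hγ (hγ1.trans (sq_min_one_le _ 𝔠.gamma0_pos)) K) 𝔠.lane.carrier) K r →
      r ≠ Hist.triv (F.P K) K →
      ∀ᵐ W ∂(fieldMeasure (F.P K) K (Matrix.specialUnitaryGroup (Fin 2) ℂ)),
        (inputOfAC 𝔠.lane (h.pkgAt γ hγ hγ1 K).X (h.pkgAt γ hγ hγ1 K).𝔖).W.mass K r W ≤ ((K : ℝ) + 1) * Real.exp A₁ := by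
  obtain ⟨A₁, hA⟩ := h.linMassEnvelopeAll_of_partialIterates γ hγ hγ1 hPI
  exact ⟨A₁, fun K r _ _ => hA K r⟩

open Classical in
/-- ★★★ **THE ORGAN ROW (S-ii) `hSii` FROM THE (α) SOCKET AND (a)′∀ ALONE** (per family, coupling in the window, depth `m > 0`): §3 then §2.  So, by
kernel, with ✓p750864 (`hPinA` ⟸ `hSii`) and ✓p749772 (`stub_pinnedStep` ⟸ `hpkg`, `π`, `hMain`, `hPinA`): **`stub_pinnedStep` ⟸ v1 socket + `hMain` +
(a)′∀[`blockAvg ℰp`]** — the floors ∕ «no-stacking» question of the v1 masses does not enter. [cite: Balaban1985UV3, (41) p.266, (67)–(71) p.273, (2) p.256, (5) p.257] -/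
theorem _root_.Summit.QuantumFields.YangMills.Theorems.AlphaInputsT3AC.Of.hSii_of_partialIterates (h : AlphaInputsT3AC.Of F 𝔠)
    (γ : ℝ) (hγ : 0 < γ) (hγ1 : γ ≤ (min 𝔠.gamma0 1) ^ 2) (m : ℕ) (hm : 0 < m)
    (hPI : ∃ c : ℝ, 0 ≤ c ∧ ∀ (K : ℕ) (ι : ∀ j k : ℕ, Measure (GaugeField (F.P K) k (Matrix.specialUnitaryGroup (Fin 2) ℂ))),
      (∀ j, ι j j = fieldMeasure (F.P K) j (Matrix.specialUnitaryGroup (Fin 2) ℂ)) →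
      (∀ j k, j ≤ k → ι j (k + 1) = (ι j k).map (avT3 F K k).avg) →
      ∀ j k, j < k → k ≤ K → ι j k ≤ ENNReal.ofReal (Real.exp c) • fieldMeasure (F.P K) k (Matrix.specialUnitaryGroup (Fin 2) ℂ)) :
    ∃ (CZ c : ℝ) (A : ℕ), 0 < c ∧
      ∀ (K j : ℕ) (hj1 : 1 ≤ j) (hjK : j + 2 ≤ K), j + (K - 1) / m ≤ K → ∀ (a : Plaq (F.P K) j),
        ∀ᵐ W ∂(fieldMeasure (F.P K) K (Matrix.specialUnitaryGroup (Fin 2) ℂ)),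
        ∑ r ∈ Finset.univ.filter (fun r : Hist (F.P K) K =>
            a ∈ r ⟨j, by omega⟩ ∨ ¬ plaqCover a ⊆ Omega 𝔠.lane.carrier.M₁
              (rcolOf (T3Scales F γ hγ (hγ1.trans (sq_min_one_le _ 𝔠.gamma0_pos)) K) 𝔠.lane.carrier) j
              (fun i : Fin j => r (Fin.castLE (by omega) i)) j),
          (inputOfAC 𝔠.lane (h.pkgAt γ hγ hγ1 K).X (h.pkgAt γ hγ hγ1 K).𝔖).W.mass K r W *
            Real.exp (-((h.pkgAt γ hγ hγ1 K).T.mainT K r W) + (h.pkgAt γ hγ hγ1 K).T.Zterm K r) ≤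
        Real.exp CZ * ((F.scheme ℰp γ).β (K - j) ^ A *
          Real.exp (-(c * B10.pFun 𝔠.b₀ 𝔠.p₀ (Real.sqrt (γ * ((F.L : ℝ)⁻¹) ^ (K - j))) ^ 2))) :=
  h.hSii_of_linMassEnvelope γ hγ hγ1 m hm (h.linMassEnvelope_of_partialIterates γ hγ hγ1 hPI)

/-! ## §4 The `∀ L` binder of the faces -/

open Classical in
/-- ★★★ **THE `∀ L`-BINDER `hSii` OF THE S-KNIT ∕ THE hP′-FACE FROM THE SOCKETS AND (a)′∀ PER FAMILY** (threshold `γ₁ := 1`; every coupling in the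
window): the hypothesis `hSii` of ✓`UV3PinnedStepKnitOfPackage.hPinA_of_pinnedLF` and of ✓p751371
`UnitScaleTiltHistoryTailOfPackagePinnedLf.pinnedHeightTail_of_package_of_pinnedLF_of_lf_ae_of_main`, verbatim, from §3 family by family.  With those two
and the LEAD socket ✓p748552 the S-half of the 19936 crux face displays `hpkg`, `π`, `hMain`, (a)′∀ — and `hlf`.
[cite: Balaban1985UV3, (41) p.266, (67)–(71) p.273, (2) p.256, (5) p.257] -/
theorem hSii_forall_of_partialIterates
    (hPI : ∀ F : T3Family, ∃ c : ℝ, 0 ≤ c ∧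
      ∀ (K : ℕ) (ι : ∀ j k : ℕ, Measure (GaugeField (F.P K) k (Matrix.specialUnitaryGroup (Fin 2) ℂ))),
      (∀ j, ι j j = fieldMeasure (F.P K) j (Matrix.specialUnitaryGroup (Fin 2) ℂ)) →
      (∀ j k, j ≤ k → ι j (k + 1) = (ι j k).map (avT3 F K k).avg) →
      ∀ j k, j < k → k ≤ K → ι j k ≤ ENNReal.ofReal (Real.exp c) • fieldMeasure (F.P K) k (Matrix.specialUnitaryGroup (Fin 2) ℂ)) :
    ∀ (L : ℕ) (𝔠 : AlphaConsts L (suGroupModel 2).N)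
      (hOf : ∀ (F : T3Family) (hF : F.L = L), AlphaInputsT3AC.Of F (hF ▸ 𝔠)),
        ∀ (m : ℕ), 0 < m →
          ∃ γ₁ : ℝ, 0 < γ₁ ∧ ∀ (F : T3Family) (hF : F.L = L)
            (γ : ℝ) (hγ : 0 < γ) (hγ1' : γ ≤ (min (hF ▸ 𝔠).gamma0 1) ^ 2), γ ≤ γ₁ →
            ∃ (CZ c : ℝ) (A : ℕ), 0 < c ∧
              ∀ (K j : ℕ) (hj1 : 1 ≤ j) (hjK : j + 2 ≤ K), j + (K - 1) / m ≤ K → ∀ (a : Plaq (F.P K) j),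
                ∀ᵐ W ∂(fieldMeasure (F.P K) K (Matrix.specialUnitaryGroup (Fin 2) ℂ)),
                ∑ r ∈ Finset.univ.filter (fun r : Hist (F.P K) K =>
                    a ∈ r ⟨j, by omega⟩ ∨ ¬ plaqCover a ⊆ Omega (hF ▸ 𝔠).lane.carrier.M₁
                      (rcolOf (T3Scales F γ hγ (hγ1'.trans (sq_min_one_le _ (hF ▸ 𝔠).gamma0_pos)) K) (hF ▸ 𝔠).lane.carrier) j
                      (fun i : Fin j => r (Fin.castLE (by omega) i)) j),
                  (inputOfAC (hF ▸ 𝔠).lane ((hOf F hF).pkgAt γ hγ hγ1' K).X ((hOf F hF).pkgAt γ hγ hγ1' K).𝔖).W.mass K r W *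
                    Real.exp (-(((hOf F hF).pkgAt γ hγ hγ1' K).T.mainT K r W) + ((hOf F hF).pkgAt γ hγ hγ1' K).T.Zterm K r) ≤
                Real.exp CZ * ((F.scheme ℰp γ).β (K - j) ^ A *
                  Real.exp (-(c * B10.pFun (hF ▸ 𝔠).b₀ (hF ▸ 𝔠).p₀ (Real.sqrt (γ * ((F.L : ℝ)⁻¹) ^ (K - j))) ^ 2))) :=
  fun _ _ hOf m hm => ⟨1, one_pos, fun F hF γ hγ hγ1' _ => (hOf F hF).hSii_of_partialIterates γ hγ hγ1' m hm (hPI F)⟩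

end Summit.QuantumFields.YangMills.Theorems.UV3PinnedStepOrganOfPartialIterates

end
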